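import Literature.IUT.HodgeTheaters.FPrimeStripsMonoLaws
import Mathlib.CategoryTheory.Groupoid
import Mathlib.CategoryTheory.NatIso
import Mathlib.Logic.Equiv.Defs
import HarnessLib

/-!
# Bridge B10 (part 1): the prime-strip GROUPOIDS of [IUTchI] §4–§5 over the landed kits, in the shapes
# the [IUTchIII] §1–§2 frame `StripFrame` consumes

Mochizuki, *Inter-universal Teichmüller Theory I*, kurims manuscript (May 2020), Def 4.1 (iv) p.96,
Def 5.2 (iii)/(iv) pp.134–135, Rmk 5.2.1 (i)(ii) p.143, Cor 5.3 (ii)(iii) p.144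
[cite: Mochizuki2012, I Def 4.1 (iv) p.96, Def 5.2 (iii) p.134, Rmk 5.2.1 p.143, Cor 5.3 (ii)(iii) p.144]
(D-0012 claim key, status disputed; BRIDGE between two landed typings — nothing of the series is asserted).

MERGE-MAP (plan/L6/MERGE-MAP.md v8) row 46 / §8 B10. The [IUTchIII] §1–§2 frame
`Literature.IUT.LogThetaLattice.StripFrame` (abc-iut-L6-t3, `PrimeStripFrame.lean`) asks for the prime-strips of
[IUTchI] as CATEGORIES (`F`, `Fv`, `Fgl` groupoids; `D`, `Dv`) with FUNCTORS `toD : F ⥤ D`, `toFv : F ⥤ Fv`,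
`FvToDv : Fv ⥤ Dv`, `DToDv : D ⥤ Dv`, `FglToFv : Fgl ⥤ Fv` and the rigidity fields
`toD_isoBij : ∀ X Y : F, Bijective (fun f : X ≅ Y => toD.mapIso f)` ([IUTchI] Cor 5.3 (ii)),
`toDv_isoSurj` (Cor 5.3 (iii)), `iso_nonempty_F`. The landed [IUTchI] §5 typing of abc-iut-L5-t4
(`FPrimeStrips.lean` p408717 over `PMBaseKit`/`MultKit`) has the prime-strips as RECORDS
(`FKit.FStrip`, `FKit.FmStrip`, `FKit.FrStrip`, `PMBaseKit.DStrip`) whose isomorphisms are TYPES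
(`FStrip.Iso F₁ F₂ := ∀ v, F₁.obj v ≅ F₂.obj v`, …) without a `Category` instance, the functorial
algorithms of Rmk 5.2.1 as object/iso-level functions (`assocD`/`assocDMap`, `mono`, `assocDm`/`assocDmMap`,
`MultKit.mono`/`monoMap`), and Cor 5.3 (ii)/(iii) as named `Prop`s (`IsomFtoDBijective`, `IsomFmtoDmSurjective`).

This file supplies exactly the missing glue, and nothing else:
* `Groupoid` instances on `K.DStrip`, `FK.FStrip`, `FK.FmStrip`, `FK.FrStrip` with `Hom :=` the landed
  `.Iso` types ("a morphism of `ℱ`- (respectively, `ℱ^⊢`-) prime-strips is defined to be a collection of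
  isomorphisms" [Def 5.2 (iii) p.134]; "a morphism of `ℱ^⊩`-prime-strips is defined to be an isomorphism
  between collections of data" [Def 5.2 (iv) p.135]; for `𝒟`-prime-strips Def 4.1 (iv) p.96 allows arbitrary
  collections of morphisms — here the ISO-groupoid, which is all [IUTchIII] §1–§2 transports; composition =
  L5-t4's `DStrip.Iso.trans`, so its poly-morphism calculus `polyComp` is categorical composition);
* the functors `assocDFunctor : FK.FStrip ⥤ K.DStrip` (Rmk 5.2.1 (i)), `monoFunctor : FK.FStrip ⥤ FK.FmStrip`
  (Rmk 5.2.1 (ii)), `rlfFmFunctor : FK.FrStrip ⥤ FK.FmStrip` (Def 5.2 (iv) (d)), and — under the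
  functoriality LAWS that the landed kits do not carry, packaged L5-side as the ONE hypothesis structure
  `PMBaseKit.FKit.MonoLaws` of abc-iut-L5-d4's `FPrimeStripsMonoLaws.lean` (MERGE-MAP B10 gaps G#1–G#3;
  L5-lead rulings 2026-08-25T22:11:27Z/22:14:40Z) — `assocDmFunctor : FK.FmStrip ⥤ M.DMono`,
  `monoDFunctor : K.DStrip ⥤ M.DMono` (Rmk 5.2.1 (i), Def 4.1 (iv)) and the NATURAL compatibility
  isomorphism `toDvComm : monoFunctor ⋙ assocDmFunctor ≅ assocDFunctor ⋙ monoDFunctor` (Rmk 5.2.1 (i)(ii);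
  the `StripFrame.toDv_comm` shape);
* the TRANSFER lemmas `toD_isoBij_iff : (∀ X Y, Bijective (mapIso)) ↔ FK.IsomFtoDBijective` and
  `toDv_isoSurj_iff : (∀ X Y, Surjective (mapIso)) ↔ FK.IsomFmtoDmSurjective` (pure category theory:
  in a groupoid `(X ≅ Y) ≃ (X ⟶ Y)`), and the connectedness facts `iso_nonempty_*` (every strip is an
  isomorph of the model strip).
The assembly `StripFrame.ofKits` (with the [IUTchI] §6 Hodge-theater half from abc-iut-L5-t4's
`ThetaPMEllHodgeTheaters` and the [IUTchII] Def 4.9 `×μ`-strips of abc-iut-L6-t2) is part 2, once those land.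
-/

namespace Literature.IUT.LogThetaLattice

open CategoryTheory
open Literature.IUT.HodgeTheaters

universe u

namespace PrimeStripGroupoids

variable {l : ℕ} {K : PMBaseKit.{u} l}

/-! ### `𝒟`-prime-strips as a groupoid (Def 4.1 (iv)) -/

/-- **IUTchI:Def4.1(iv)** (kurims p.96) The groupoid of `𝒟`-prime-strips over a base kit: `Hom †𝔇 ‡𝔇 :=` abc-iut-L5-t4's
`DStrip.Iso` ("a collection of morphisms, indexed by `𝕍`", here isomorphisms), composition/identity/inverse
componentwise (definitionally L5-t4's `DStrip.Iso.trans/refl/symm`, so its `polyComp` is categorical composition).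
[claim: Mochizuki2012, status: disputed] -/
instance instGroupoidDStrip : Groupoid K.DStrip where
  Hom D₁ D₂ := D₁.Iso D₂
  id D := fun v => Iso.refl (D.obj v)
  comp f g := fun v => f v ≪≫ g v
  inv f := fun v => (f v).symm
  id_comp f := by funext v; exact Iso.refl_trans (f v)
  comp_id f := by funext v; exact Iso.trans_refl (f v)
  assoc f g h := by funext v; exact Iso.trans_assoc (f v) (g v) (h v)
  inv_comp f := by funext v; exact Iso.symm_self_id (f v)
  comp_inv f := by funext v; exact Iso.self_symm_id (f v)

/-- **IUTchI:Def4.1(iv)** (kurims p.96) Morphisms of the groupoid of `𝒟`-prime-strips ARE L5-t4's `DStrip.Iso` (by definition).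
[claim: Mochizuki2012, status: disputed] -/
theorem hom_DStrip_eq (D₁ D₂ : K.DStrip) : (D₁ ⟶ D₂) = D₁.Iso D₂ := rfl

/-- **IUTchI:Def4.1(iv)** (kurims p.96) Composition in the groupoid of `𝒟`-prime-strips IS L5-t4's `DStrip.Iso.trans`
(so `DStrip.polyComp` is composition of poly-isomorphisms in this groupoid). [claim: Mochizuki2012, status: disputed] -/
theorem comp_DStrip_eq_trans {D₁ D₂ D₃ : K.DStrip} (f : D₁ ⟶ D₂) (g : D₂ ⟶ D₃) :
    f ≫ g = PMBaseKit.DStrip.Iso.trans f g := rfl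

/-- **IUTchI:Def4.1(iv)** (kurims p.96) Composition in the groupoid of `𝒟`-prime-strips is componentwise `Iso.trans`.
[claim: Mochizuki2012, status: disputed] -/
@[simp] theorem comp_DStrip_apply {D₁ D₂ D₃ : K.DStrip} (f : D₁ ⟶ D₂) (g : D₂ ⟶ D₃) (v : K.V) :
    (f ≫ g) v = f v ≪≫ g v := rfl

/-- **IUTchI:Def4.1(iv)** (kurims p.96) The identity of a `𝒟`-prime-strip is componentwise `Iso.refl`.
[claim: Mochizuki2012, status: disputed] -/
@[simp] theorem id_DStrip_apply (D : K.DStrip) (v : K.V) : (𝟙 D : D ⟶ D) v = Iso.refl (D.obj v) := rfl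

/-- **IUTchI:Def4.1(i)** (kurims p.95) Any two `𝒟`-prime-strips are isomorphic (every constituent is an isomorph of the
model `𝒟_v`). [claim: Mochizuki2012, status: disputed] -/
theorem iso_nonempty_DStrip (D₁ D₂ : K.DStrip) : Nonempty (D₁ ≅ D₂) :=
  ⟨(Groupoid.isoEquivHom D₁ D₂).symm fun v => (D₁.isLocal v).some ≪≫ (D₂.isLocal v).some.symm⟩

variable {M : K.MultKit} {FK : K.FKit M}

/-! ### `ℱ`-, `ℱ^⊢`-, `ℱ^⊩`-prime-strips as groupoids (Def 5.2 (iii), (iv)) -/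

/-- **IUTchI:Def5.2(iii)** (kurims p.134) The groupoid of `ℱ`-prime-strips: "a morphism of `ℱ`- … prime-strips is defined to
be a collection of isomorphisms, indexed by `𝕍`, between the various constituent objects of the prime-strips"
— `Hom ¹𝔉 ²𝔉 :=` L5-t4's `FStrip.Iso`, composed componentwise. [claim: Mochizuki2012, status: disputed] -/
instance instGroupoidFStrip : Groupoid FK.FStrip where
  Hom F₁ F₂ := F₁.Iso F₂
  id F := fun v => Iso.refl (F.obj v)
  comp f g := fun v => f v ≪≫ g v
  inv f := fun v => (f v).symm
  id_comp f := by funext v; exact Iso.refl_trans (f v)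
  comp_id f := by funext v; exact Iso.trans_refl (f v)
  assoc f g h := by funext v; exact Iso.trans_assoc (f v) (g v) (h v)
  inv_comp f := by funext v; exact Iso.symm_self_id (f v)
  comp_inv f := by funext v; exact Iso.self_symm_id (f v)

/-- **IUTchI:Def5.2(iii)** (kurims p.134) The groupoid of `ℱ^⊢`-prime-strips ("respectively, `ℱ^⊢`-"): `Hom :=` L5-t4's
`FmStrip.Iso`, componentwise. [claim: Mochizuki2012, status: disputed] -/
instance instGroupoidFmStrip : Groupoid FK.FmStrip where
  Hom F₁ F₂ := F₁.Iso F₂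
  id F := fun v => Iso.refl (F.obj v)
  comp f g := fun v => f v ≪≫ g v
  inv f := fun v => (f v).symm
  id_comp f := by funext v; exact Iso.refl_trans (f v)
  comp_id f := by funext v; exact Iso.trans_refl (f v)
  assoc f g h := by funext v; exact Iso.trans_assoc (f v) (g v) (h v)
  inv_comp f := by funext v; exact Iso.symm_self_id (f v)
  comp_inv f := by funext v; exact Iso.self_symm_id (f v)

/-- **IUTchI:Def5.2(iv)** (kurims p.135) The groupoid of `ℱ^⊩`-prime-strips: "a morphism of `ℱ^⊩`-prime-strips is defined
to be an isomorphism between collections of data" — `Hom :=` L5-t4's `FrStrip.Iso` (an isomorphism of the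
ambient category of collections of data). [claim: Mochizuki2012, status: disputed] -/
instance instGroupoidFrStrip : Groupoid FK.FrStrip where
  Hom F₁ F₂ := F₁.Iso F₂
  id F := Iso.refl F.obj
  comp f g := Iso.trans f g
  inv f := Iso.symm f
  id_comp f := Iso.refl_trans f
  comp_id f := Iso.trans_refl f
  assoc f g h := Iso.trans_assoc f g h
  inv_comp f := Iso.symm_self_id f
  comp_inv f := Iso.self_symm_id f

/-- **IUTchI:Def5.2(iii)** (kurims p.134) Morphisms of the groupoid of `ℱ`-prime-strips ARE `FStrip.Iso`.
[claim: Mochizuki2012, status: disputed] -/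
theorem hom_FStrip_eq (F₁ F₂ : FK.FStrip) : (F₁ ⟶ F₂) = F₁.Iso F₂ := rfl

/-- **IUTchI:Def5.2(iii)** (kurims p.134) Morphisms of the groupoid of `ℱ^⊢`-prime-strips ARE `FmStrip.Iso`.
[claim: Mochizuki2012, status: disputed] -/
theorem hom_FmStrip_eq (F₁ F₂ : FK.FmStrip) : (F₁ ⟶ F₂) = F₁.Iso F₂ := rfl

/-- **IUTchI:Def5.2(iv)** (kurims p.135) Morphisms of the groupoid of `ℱ^⊩`-prime-strips ARE `FrStrip.Iso`.
[claim: Mochizuki2012, status: disputed] -/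
theorem hom_FrStrip_eq (F₁ F₂ : FK.FrStrip) : (F₁ ⟶ F₂) = F₁.Iso F₂ := rfl

/-- **IUTchI:Def5.2(iii)** (kurims p.134) Composition of morphisms of `ℱ`-prime-strips is componentwise.
[claim: Mochizuki2012, status: disputed] -/
@[simp] theorem comp_FStrip_apply {F₁ F₂ F₃ : FK.FStrip} (f : F₁ ⟶ F₂) (g : F₂ ⟶ F₃) (v : K.V) :
    (f ≫ g) v = f v ≪≫ g v := rfl

/-- **IUTchI:Def5.2(iii)** (kurims p.134) The identity of an `ℱ`-prime-strip is componentwise `Iso.refl`.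
[claim: Mochizuki2012, status: disputed] -/
@[simp] theorem id_FStrip_apply (F : FK.FStrip) (v : K.V) : (𝟙 F : F ⟶ F) v = Iso.refl (F.obj v) := rfl

/-- **IUTchI:Def5.2(iii)** (kurims p.134) Composition of morphisms of `ℱ^⊢`-prime-strips is componentwise.
[claim: Mochizuki2012, status: disputed] -/
@[simp] theorem comp_FmStrip_apply {F₁ F₂ F₃ : FK.FmStrip} (f : F₁ ⟶ F₂) (g : F₂ ⟶ F₃) (v : K.V) :
    (f ≫ g) v = f v ≪≫ g v := rfl

/-- **IUTchI:Def5.2(iii)** (kurims p.134) The identity of an `ℱ^⊢`-prime-strip is componentwise `Iso.refl`.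
[claim: Mochizuki2012, status: disputed] -/
@[simp] theorem id_FmStrip_apply (F : FK.FmStrip) (v : K.V) : (𝟙 F : F ⟶ F) v = Iso.refl (F.obj v) := rfl

/-- **IUTchI:Def5.2(i)** (kurims p.134) Any two `ℱ`-prime-strips are isomorphic ("admits an equivalence of categories
`‡𝒞_v ⥲ 𝒞_v`" to the model at each `v`) — the `StripFrame.iso_nonempty_F` field shape.
[claim: Mochizuki2012, status: disputed] -/
theorem iso_nonempty_FStrip (F₁ F₂ : FK.FStrip) : Nonempty (F₁ ≅ F₂) :=
  ⟨(Groupoid.isoEquivHom F₁ F₂).symm fun v => (F₁.isModel v).some ≪≫ (F₂.isModel v).some.symm⟩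

/-- **IUTchI:Def5.2(ii)** (kurims p.134) Any two `ℱ^⊢`-prime-strips are isomorphic. [claim: Mochizuki2012, status: disputed] -/
theorem iso_nonempty_FmStrip (F₁ F₂ : FK.FmStrip) : Nonempty (F₁ ≅ F₂) :=
  ⟨(Groupoid.isoEquivHom F₁ F₂).symm fun v => (F₁.isModel v).some ≪≫ (F₂.isModel v).some.symm⟩

/-- **IUTchI:Def5.2(iv)** (kurims p.135) Any two `ℱ^⊩`-prime-strips are isomorphic ("(f) … isomorphic to … `ℱ^⊩_mod`").
[claim: Mochizuki2012, status: disputed] -/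
theorem iso_nonempty_FrStrip (F₁ F₂ : FK.FrStrip) : Nonempty (F₁ ≅ F₂) :=
  ⟨(Groupoid.isoEquivHom F₁ F₂).symm (F₁.isModel.some ≪≫ F₂.isModel.some.symm)⟩

/-! ### The functorial algorithms of Rmk 5.2.1 as functors -/

variable (FK) in
/-- **IUTchI:Rmk5.2.1(i)** (kurims p.143) "a functorial algorithm for constructing `𝒟`- … prime-strips from `ℱ`- … prime-strips":
L5-t4's `FStrip.assocD` / `assocDMap` as a functor `FK.FStrip ⥤ K.DStrip` — the `StripFrame.toD` shape.
[claim: Mochizuki2012, status: disputed] -/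
noncomputable def assocDFunctor : FK.FStrip ⥤ K.DStrip where
  obj F := F.assocD
  map φ := PMBaseKit.FKit.FStrip.assocDMap φ
  map_id F := by funext v; exact (FK.toD v).mapIso_refl _
  map_comp f g := by funext v; exact (FK.toD v).mapIso_trans (f v) (g v)

/-- **IUTchI:Rmk5.2.1(i)** (kurims p.143) On morphisms the functor IS the "natural map `Isom(¹𝔉, ²𝔉) → Isom(¹𝔇, ²𝔇)`"
(`FStrip.assocDMap`). [claim: Mochizuki2012, status: disputed] -/
theorem assocDFunctor_map {F₁ F₂ : FK.FStrip} (φ : F₁ ⟶ F₂) :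
    (assocDFunctor FK).map φ = PMBaseKit.FKit.FStrip.assocDMap φ := rfl

variable (FK) in
/-- **IUTchI:Rmk5.2.1(ii)** (kurims p.143) "a functorial algorithm for constructing from an `ℱ`-prime-strip `‡𝔉` an
`ℱ^⊢`-prime-strip `‡𝔉^⊢` … the mono-analyticization": L5-t4's `FStrip.mono` as a functor — the `StripFrame.toFv` shape.
[claim: Mochizuki2012, status: disputed] -/
noncomputable def monoFunctor : FK.FStrip ⥤ FK.FmStrip where
  obj F := F.mono
  map φ := fun v => (FK.toFm v).mapIso (φ v)
  map_id F := by funext v; exact (FK.toFm v).mapIso_refl _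
  map_comp f g := by funext v; exact (FK.toFm v).mapIso_trans (f v) (g v)

variable (FK) in
/-- **IUTchI:Def5.2(iv)** (kurims p.135) The `ℱ^⊢`-prime-strip (d) `‡𝔉^⊢` underlying an `ℱ^⊩`-prime-strip, functorially
(L5-t4's `FrStrip.fmStrip` under its model-preservation hypothesis `h`) — the `StripFrame.FglToFv` shape.
[claim: Mochizuki2012, status: disputed] -/
def rlfFmFunctor (h : ∀ v, Nonempty ((FK.rlfFm v).obj FK.rlfModel ≅ FK.fmModel v)) :
    FK.FrStrip ⥤ FK.FmStrip where
  obj F := F.fmStrip h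
  map φ := fun v => (FK.rlfFm v).mapIso φ
  map_id F := by funext v; exact (FK.rlfFm v).mapIso_refl _
  map_comp f g := by funext v; exact (FK.rlfFm v).mapIso_trans f g

/-- **IUTchI:Rmk5.2.1(i)** (kurims p.143) "`𝒟^⊢`-prime-strips from `ℱ^⊢`-prime-strips": L5-t4's `FmStrip.assocDm`/`assocDmMap`
as a functor `FK.FmStrip ⥤ M.DMono` under abc-iut-L5-d4's laws `L : FK.MonoLaws` — the `StripFrame.FvToDv` shape.
[claim: Mochizuki2012, status: disputed] -/
def assocDmFunctor (L : FK.MonoLaws) : FK.FmStrip ⥤ M.DMono where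
  obj F := F.assocDm
  map φ := PMBaseKit.FKit.FmStrip.assocDmMap φ
  map_id F := L.toDmMap_refl F.obj
  map_comp f g := L.toDmMap_trans f g

/-- **IUTchI:Rmk5.2.1(i)** (kurims p.143) On morphisms `assocDmFunctor` IS the "natural map `Isom(¹𝔉^⊢, ²𝔉^⊢) → Isom(¹𝔇^⊢, ²𝔇^⊢)`"
(`FmStrip.assocDmMap`). [claim: Mochizuki2012, status: disputed] -/
theorem assocDmFunctor_map (L : FK.MonoLaws) {F₁ F₂ : FK.FmStrip} (φ : F₁ ⟶ F₂) :
    (assocDmFunctor L).map φ = PMBaseKit.FKit.FmStrip.assocDmMap φ := rfl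

/-- **IUTchI:Def4.1(iv)** (kurims p.96) Mono-analyticisation `†𝔇 ↦ †𝔇^⊢` (L5-t4's `MultKit.mono`/`monoMap`) as a functor
`K.DStrip ⥤ M.DMono` under abc-iut-L5-d4's laws `L : FK.MonoLaws` — the `StripFrame.DToDv` shape.
[claim: Mochizuki2012, status: disputed] -/
def monoDFunctor (L : FK.MonoLaws) : K.DStrip ⥤ M.DMono where
  obj D := M.mono D
  map φ := M.monoMap φ
  map_id D := L.monoMap_refl D
  map_comp f g := L.monoMap_trans f g

/-- **IUTchI:Rmk5.2.1(i)** (kurims p.143) The compatibility `(𝔉 ↦ 𝔉^⊢ ↦ 𝔇^⊢) = (𝔉 ↦ 𝔇 ↦ 𝔇^⊢)` (Rmk 5.2.1 (i), (ii); Def 4.1 (iv))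
as a NATURAL ISOMORPHISM of functors `FK.FStrip ⥤ M.DMono`, from the chosen, natural comparison of abc-iut-L5-d4's
laws (`toDmToFm`, `toDmToFm_natural`) — the `StripFrame.toDv_comm` shape. [claim: Mochizuki2012, status: disputed] -/
noncomputable def toDvComm (L : FK.MonoLaws) :
    monoFunctor FK ⋙ assocDmFunctor L ≅ assocDFunctor FK ⋙ monoDFunctor L :=
  NatIso.ofComponents (fun F => L.toDmToFm F) (fun φ => L.toDmToFm_natural φ)

/-- **IUTchI:Rmk5.2.1(i)** (kurims p.143) The components of `toDvComm` are the chosen comparison isomorphisms.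
[claim: Mochizuki2012, status: disputed] -/
@[simp] theorem toDvComm_app (L : FK.MonoLaws) (F : FK.FStrip) : (toDvComm L).app F = L.toDmToFm F := rfl

/-! ### Transfer of Cor 5.3 (ii), (iii) to the `StripFrame` field shapes -/

section Transfer

variable {C : Type*} [Groupoid C] {E : Type*} [Groupoid E] (G : C ⥤ E) (X Y : C)

/-- **IUTchI:Cor5.3(ii)** (kurims p.144) Category theory: for a functor between groupoids, `f ↦ G.mapIso f` on ISOMORPHISMS is
`G.map` on morphisms conjugated by the groupoid identifications `(X ≅ Y) ≃ (X ⟶ Y)`.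
[claim: Mochizuki2012, status: disputed] -/
theorem mapIso_eq_conj :
    (fun f : X ≅ Y => G.mapIso f) =
      (Groupoid.isoEquivHom (G.obj X) (G.obj Y)).symm ∘ G.map ∘ Groupoid.isoEquivHom X Y := by
  funext f
  exact Iso.ext rfl

/-- **IUTchI:Cor5.3(ii)** (kurims p.144) Hence `mapIso` is bijective on isomorphisms iff `map` is bijective on morphisms.
[claim: Mochizuki2012, status: disputed] -/
theorem bijective_mapIso_iff :
    Function.Bijective (fun f : X ≅ Y => G.mapIso f) ↔
      Function.Bijective (G.map : (X ⟶ Y) → (G.obj X ⟶ G.obj Y)) := by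
  rw [mapIso_eq_conj, Equiv.comp_bijective, Equiv.bijective_comp]

/-- **IUTchI:Cor5.3(iii)** (kurims p.144) … and `mapIso` is surjective on isomorphisms iff `map` is surjective on morphisms.
[claim: Mochizuki2012, status: disputed] -/
theorem surjective_mapIso_iff :
    Function.Surjective (fun f : X ≅ Y => G.mapIso f) ↔
      Function.Surjective (G.map : (X ⟶ Y) → (G.obj X ⟶ G.obj Y)) := by
  rw [mapIso_eq_conj, Equiv.comp_surjective, Equiv.surjective_comp]

end Transfer

/-- **IUTchI:Cor5.3(ii)** (kurims p.144) TRANSFER: the `StripFrame.toD_isoBij` field, instantiated at `toD := assocDFunctor FK`,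
is EQUIVALENT to L5-t4's named statement `FKit.IsomFtoDBijective` ("the natural map `Isom(¹𝔉, ²𝔉) → Isom(¹𝔇, ²𝔇)`
is bijective"). Neither side is asserted. [claim: Mochizuki2012, status: disputed] -/
theorem toD_isoBij_iff :
    (∀ X Y : FK.FStrip, Function.Bijective (fun f : X ≅ Y => (assocDFunctor FK).mapIso f)) ↔
      FK.IsomFtoDBijective :=
  forall₂_congr fun X Y => bijective_mapIso_iff (assocDFunctor FK) X Y

/-- **IUTchI:Cor5.3(iii)** (kurims p.144) TRANSFER: the `StripFrame.toDv_isoSurj` field, instantiated at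
`FvToDv := assocDmFunctor L`, is EQUIVALENT to L5-t4's named statement `FKit.IsomFmtoDmSurjective`
("the natural map `Isom(¹𝔉^⊢, ²𝔉^⊢) → Isom(¹𝔇^⊢, ²𝔇^⊢)` is surjective"). Neither side is asserted.
[claim: Mochizuki2012, status: disputed] -/
theorem toDv_isoSurj_iff (L : FK.MonoLaws) :
    (∀ X Y : FK.FmStrip, Function.Surjective (fun f : X ≅ Y => (assocDmFunctor L).mapIso f)) ↔
      FK.IsomFmtoDmSurjective :=
  forall₂_congr fun X Y => surjective_mapIso_iff (assocDmFunctor L) X Y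

/-- **IUTchI:Cor5.3(ii)** (kurims p.144) Under `FKit.IsomFtoDBijective`, `Isom(¹𝔉, ²𝔉) ⥲ Isom(¹𝔇, ²𝔇)` as an `Equiv` of
categorical isomorphism types (the shape `StripFrame.isoEquiv` is built from). [claim: Mochizuki2012, status: disputed] -/
noncomputable def isoEquivOfBijective (h : FK.IsomFtoDBijective) (X Y : FK.FStrip) :
    (X ≅ Y) ≃ ((assocDFunctor FK).obj X ≅ (assocDFunctor FK).obj Y) :=
  Equiv.ofBijective _ ((toD_isoBij_iff).2 h X Y)

/-- **IUTchI:Cor5.3(ii)** (kurims p.144) The equivalence is `mapIso`. [claim: Mochizuki2012, status: disputed] -/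
@[simp] theorem isoEquivOfBijective_apply (h : FK.IsomFtoDBijective) {X Y : FK.FStrip} (f : X ≅ Y) :
    isoEquivOfBijective h X Y f = (assocDFunctor FK).mapIso f := rfl

/-! ### Non-vacuity: everything instantiates over the toy kits -/

/-- **IUTchI:Rmk5.2.1(i)** (kurims p.143) Over L5-t4's toy kits with abc-iut-L5-d4's `MonoLaws.toy`, the compatibility natural
isomorphism is the identity (all `𝒟^⊢`-data are the unique object/morphism): the constructions above are
jointly instantiable. [claim: Mochizuki2012, status: disputed] -/
theorem toDvComm_toy_app (l : ℕ) [Fact l.Prime] (hl : l ≠ 2) (F : (PMBaseKit.FKit.toy l hl).FStrip) :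
    ((toDvComm (PMBaseKit.FKit.MonoLaws.toy l hl)).app F).hom = 𝟙 _ := rfl

end PrimeStripGroupoids

end Literature.IUT.LogThetaLattice
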